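import Literature.NumberTheory.LFunctions.RayClassCosetReps
import Literature.NumberTheory.LFunctions.HeckeThetaDirichlet
import Literature.NumberTheory.LFunctions.HeckePieceDirichlet
import HarnessLib

/-!
# Box representatives of `1 + 𝔪𝔟⁻¹` modulo `V = ⟨u_i^N⟩` and the fibres of `x ↦ x𝔟`

Topic `Literature/NumberTheory/LFunctions`; namespace `Literature.NumberTheory.LFunctions.NumberField`
(continuing `RayClassCosetReps.lean`).  For `𝔪 ≠ 0`, a nonzero integral ideal `𝔟` prime to `𝔪`, `𝔞 = 𝔪𝔟⁻¹`,
`T = rayCosetPos 𝔪 𝔟` and an even `N ≠ 0` with `V = ⟨u_i^N⟩` acting on `T` (e.g. `N = rayUnitExp 𝔪`), we PROVE: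

* `boxRep N x = u_{N⌊m(x)/N⌋} x` normalises `x ∈ T` into the **box representatives**
  `T_N = rayCosetPosReps 𝔪 𝔟 N = T ∩ pieceReps K ∅ 1 𝔞 1 N` (cone exponent in `[0,N)^{r-1}`); it is `V`-invariant and
  fixes `T_N` (`boxRep_fundUnit_nsmul_mul`, `boxRep_eq_self`), so `T_N` is a system of representatives of `T`
  modulo `V`;
* the fibres `rayFib 𝔪 𝔟 N 𝔞' = {x ∈ T_N | x𝔟 = 𝔞'}` of `x ↦ x𝔟` are empty unless `𝔞'` lies in the narrow ray class
  of `𝔟` (`rayClassRel_of_mem_rayFib`), and are otherwise all in bijection with the fibre over `𝔟`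
  (`rayFibEquiv`, through the transport `fibMap`), which is finite (`finite_rayFib`: its points have `|N(x)| = 1`
  and `Σ_{x ∈ ℜ} |N(x)|^{-2} < ∞`) and nonempty; hence **each ideal of the class is hit exactly
  `d = rayFibCard 𝔪 𝔟 N` times** (`card_rayFib`; `d = #(U/V)` for the totally positive units `U ≡ 1 mod 𝔪`).

This is the counting behind Neukirch VII (5.3)–(5.4) (`ζ(𝔎,s) = 𝔑(𝔟)^{-s} Σ_{𝔟^*/𝒪^*} |N(a)|^{-s}`) for narrow
ray classes (VII §8 Remark 1), with Mathlib's fundamental cone in place of a fundamental domain for the units.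

## References

* J. Neukirch, *Algebraic Number Theory*, Grundlehren 322, Springer 1999, Ch. VI §1 (1.7)–(1.9); Ch. VII §5
  (5.3)–(5.4), §8 Remark 1 after (8.6). [NeukirchANT1999]
-/

noncomputable section

open NumberField NumberField.InfinitePlace NumberField.Units NumberField.mixedEmbedding FractionalIdeal
open scoped NumberField nonZeroDivisors

namespace Literature.NumberTheory.LFunctions

namespace NumberField

variable {K : Type*} [Field K] [NumberField K]

open scoped Classical

variable {𝔪 𝔟 : Ideal (𝓞 K)}

/-! ## Box representatives modulo `V` and the fibres of `x ↦ x𝔟` -/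

/-- **The box representatives** `T_N = T ∩ cosetReps K 𝔞 1 N`: totally positive points of `1 + 𝔪𝔟⁻¹` whose cone
exponent lies in `[0,N)^{r-1}` (representatives of `T` modulo `V = ⟨u_i^N⟩`). [folklore] -/
def rayCosetPosReps (𝔪 𝔟 : Ideal (𝓞 K)) (N : ℕ) : Set K :=
  {x | x ∈ pieceReps K ∅ 1 (rayCosetIdeal 𝔪 𝔟) 1 N ∧ IsTotPos K x}

/-- `T_N ⊆ T`. [folklore] -/
theorem mem_rayCosetPos_of_mem_reps {N : ℕ} {x : K} (hx : x ∈ rayCosetPosReps 𝔪 𝔟 N) : x ∈ rayCosetPos 𝔪 𝔟 :=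
  ⟨hx.1.1, hx.1.2.1.1, hx.2⟩

variable (K) in
/-- **Normalisation into the box**: `boxRep N x = u_{N⌊m(x)/N⌋} · x`, the `V`-translate of `x` whose cone exponent
lies in `[0, N)^{r-1}` (`coneExp_rep_mem_Ico`). [folklore] -/
def boxRep (N : ℕ) (x : K) : K := (fundUnit K (N • fun i ↦ coneExp x i / (N : ℤ)) : K) * x

/-- `boxRep N x ∈ T_N` for `x ∈ T` (even `N ≠ 0`, `V` stabilising the coset). [folklore] -/
theorem boxRep_mem_rayCosetPosReps {N : ℕ} (hN0 : N ≠ 0) (hN : Even N)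
    (hV : ∀ i, (((fundSystem K i : (𝓞 K)ˣ) : K) ^ N - 1) * 1 ∈ rayCosetIdeal 𝔪 𝔟) {x : K} (hx : x ∈ rayCosetPos 𝔪 𝔟) :
    boxRep K N x ∈ rayCosetPosReps 𝔪 𝔟 N := by
  have h := mul_mem_rayCosetPos (fundUnit_nsmul_mem_rayCosetUnits hN hV (fun i ↦ coneExp x i / (N : ℤ))) hx
  exact ⟨⟨h.1, (signPiece_empty_one_iff _).mpr h.2.1, fun i ↦ coneExp_rep_mem_Ico hN0 hx.2.1 i⟩, h.2.2⟩

/-- A unit of `𝒪` generates the unit fractional ideal. [folklore] -/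
theorem spanSingleton_coe_unit (u : (𝓞 K)ˣ) : spanSingleton (𝓞 K)⁰ ((u : 𝓞 K) : K) = 1 := by
  rw [show ((u : 𝓞 K) : K) = algebraMap (𝓞 K) K (u : 𝓞 K) from rfl, ← coeIdeal_span_singleton,
    Ideal.span_singleton_eq_top.mpr (Units.isUnit _), coeIdeal_top]

/-- `boxRep` does not change the generated ideal. [folklore] -/
theorem spanSingleton_boxRep (N : ℕ) (x : K) : spanSingleton (𝓞 K)⁰ (boxRep K N x) = spanSingleton (𝓞 K)⁰ x := by
  rw [boxRep, ← spanSingleton_mul_spanSingleton, spanSingleton_coe_unit, one_mul]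

/-- Points already in the box are fixed by `boxRep`. [folklore] -/
theorem boxRep_eq_self {N : ℕ} {x : K} (hbox : ∀ i, coneExp x i ∈ Set.Ico (0 : ℤ) N) : boxRep K N x = x := by
  have : (N • fun i ↦ coneExp x i / (N : ℤ)) = 0 := by
    funext i
    rw [Pi.smul_apply, Pi.zero_apply, Int.ediv_eq_zero_of_lt (hbox i).1 (hbox i).2, smul_zero]
  rw [boxRep, this, fundUnit_zero, _root_.NumberField.Units.coe_one, one_mul]

/-- **`boxRep` is `V`-invariant**: `boxRep (u_{Nq} x) = boxRep x` for `x ≠ 0`. [folklore] -/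
theorem boxRep_fundUnit_nsmul_mul {N : ℕ} (hN0 : N ≠ 0) (q : Fin (rank K) → ℤ) {x : K} (hx : x ≠ 0) :
    boxRep K N ((fundUnit K (N • q) : K) * x) = boxRep K N x := by
  have hN' : (N : ℤ) ≠ 0 := by exact_mod_cast hN0
  have hexp : (N • fun i ↦ coneExp ((fundUnit K (N • q) : K) * x) i / (N : ℤ)) =
      (N • fun i ↦ coneExp x i / (N : ℤ)) + -(N • q) := by
    funext i
    have h1 : coneExp ((fundUnit K (N • q) : K) * x) i = coneExp x i + (N : ℤ) * (-q i) := by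
      rw [coneExp_fundUnit_mul _ hx, Pi.sub_apply, Pi.smul_apply, nsmul_eq_mul]
      ring
    simp only [Pi.add_apply, Pi.smul_apply, Pi.neg_apply, h1, Int.add_mul_ediv_left _ _ hN']
    ring
  rw [boxRep, boxRep, hexp, fundUnit_add, _root_.NumberField.Units.coe_mul, mul_assoc, fundUnit_neg_mul_fundUnit_mul]

variable (K) in
/-- **The transport between fibres**: `Φ_{x₀→x₁}(x) = boxRep (x x₀⁻¹ x₁)`. [folklore] -/
def fibMap (N : ℕ) (x₀ x₁ x : K) : K := boxRep K N (x / x₀ * x₁)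

/-- `Φ_{x₀→x₁}` maps the fibre over `(x₀)` into the fibre over `(x₁)` (for `x₀, x₁ ∈ T`). [folklore] -/
theorem fibMap_mem {N : ℕ} (hN0 : N ≠ 0) (hN : Even N)
    (hV : ∀ i, (((fundSystem K i : (𝓞 K)ˣ) : K) ^ N - 1) * 1 ∈ rayCosetIdeal 𝔪 𝔟) {x₀ x₁ x : K}
    (hx₀ : x₀ ∈ rayCosetPos 𝔪 𝔟) (hx₁ : x₁ ∈ rayCosetPos 𝔪 𝔟) (hx : x ∈ rayCosetPosReps 𝔪 𝔟 N)
    (heq : spanSingleton (𝓞 K)⁰ x = spanSingleton (𝓞 K)⁰ x₀) :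
    fibMap K N x₀ x₁ x ∈ rayCosetPosReps 𝔪 𝔟 N ∧ spanSingleton (𝓞 K)⁰ (fibMap K N x₀ x₁ x) = spanSingleton (𝓞 K)⁰ x₁ := by
  have he := div_mem_rayCosetUnits hx₀ (mem_rayCosetPos_of_mem_reps hx) heq
  have h1 : x / x₀ * x₁ ∈ rayCosetPos 𝔪 𝔟 := mul_mem_rayCosetPos he hx₁
  refine ⟨boxRep_mem_rayCosetPosReps hN0 hN hV h1, ?_⟩
  rw [fibMap, spanSingleton_boxRep, ← spanSingleton_mul_spanSingleton, he.2.2, one_mul]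

/-- `Φ_{x₁→x₀} ∘ Φ_{x₀→x₁} = id` on the fibre over `(x₀)` (`V`-invariance of `boxRep`). [folklore] -/
theorem fibMap_fibMap {N : ℕ} (hN0 : N ≠ 0) {x₀ x₁ x : K} (hx₀ : x₀ ≠ 0) (hx₁ : x₁ ≠ 0)
    (hx : x ∈ rayCosetPosReps 𝔪 𝔟 N) : fibMap K N x₁ x₀ (fibMap K N x₀ x₁ x) = x := by
  have hxx : x ≠ 0 := hx.1.2.1.1
  rw [fibMap, fibMap]
  set q : Fin (rank K) → ℤ := fun i ↦ coneExp (x / x₀ * x₁) i / (N : ℤ) with hq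
  have hy : boxRep K N (x / x₀ * x₁) = (fundUnit K (N • q) : K) * (x / x₀ * x₁) := rfl
  have : (fundUnit K (N • q) : K) * (x / x₀ * x₁) / x₁ * x₀ = (fundUnit K (N • q) : K) * x := by
    field_simp
  rw [hy, this, boxRep_fundUnit_nsmul_mul hN0 q hxx, boxRep_eq_self hx.1.2.2]

/-- **The fibres over two ideals of `T` are in bijection.** [folklore] -/
def fibEquiv {N : ℕ} (hN0 : N ≠ 0) (hN : Even N)
    (hV : ∀ i, (((fundSystem K i : (𝓞 K)ˣ) : K) ^ N - 1) * 1 ∈ rayCosetIdeal 𝔪 𝔟) {x₀ x₁ : K}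
    (hx₀ : x₀ ∈ rayCosetPos 𝔪 𝔟) (hx₁ : x₁ ∈ rayCosetPos 𝔪 𝔟) :
    {x : K // x ∈ rayCosetPosReps 𝔪 𝔟 N ∧ spanSingleton (𝓞 K)⁰ x = spanSingleton (𝓞 K)⁰ x₀} ≃
      {x : K // x ∈ rayCosetPosReps 𝔪 𝔟 N ∧ spanSingleton (𝓞 K)⁰ x = spanSingleton (𝓞 K)⁰ x₁} where
  toFun x := ⟨fibMap K N x₀ x₁ x, fibMap_mem hN0 hN hV hx₀ hx₁ x.2.1 x.2.2⟩
  invFun x := ⟨fibMap K N x₁ x₀ x, fibMap_mem hN0 hN hV hx₁ hx₀ x.2.1 x.2.2⟩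
  left_inv x := Subtype.ext (fibMap_fibMap hN0 hx₀.2.1 hx₁.2.1 x.2.1)
  right_inv x := Subtype.ext (fibMap_fibMap hN0 hx₁.2.1 hx₀.2.1 x.2.1)

/-! ## The fibres of `x ↦ x𝔟` on `T_N` -/

/-- **The fibre of `x ↦ x𝔟` over `𝔞'` in `T_N`**: `rayFib 𝔪 𝔟 N 𝔞' = {x ∈ T_N | x𝔟 = 𝔞'}`. [folklore] -/
def rayFib (𝔪 𝔟 : Ideal (𝓞 K)) (N : ℕ) (𝔞' : Ideal (𝓞 K)) : Set K :=
  {x | x ∈ rayCosetPosReps 𝔪 𝔟 N ∧ spanSingleton (𝓞 K)⁰ x * (𝔟 : FractionalIdeal (𝓞 K)⁰ K) = 𝔞'}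

/-- A nonempty fibre lies over an ideal of the narrow ray class of `𝔟`. [folklore] -/
theorem rayClassRel_of_mem_rayFib (h𝔟 : 𝔟 ≠ ⊥) (hcop : IsCoprime 𝔟 𝔪) {N : ℕ} {𝔞' : Ideal (𝓞 K)} {x : K}
    (hx : x ∈ rayFib 𝔪 𝔟 N 𝔞') : RayClassRel 𝔪 𝔟 𝔞' :=
  rayClassRel_of_mem_rayCosetPos h𝔟 hcop (mem_rayCosetPos_of_mem_reps hx.1) hx.2.symm

/-- The fibre over an ideal `x₀𝔟`, `x₀ ∈ T`, as the `x ∈ T_N` generating `(x₀)`. [folklore] -/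
theorem mem_rayFib_iff (h𝔟 : 𝔟 ≠ ⊥) {N : ℕ} {𝔞' : Ideal (𝓞 K)} {x₀ : K}
    (h𝔞' : (𝔞' : FractionalIdeal (𝓞 K)⁰ K) = spanSingleton (𝓞 K)⁰ x₀ * 𝔟) (x : K) :
    x ∈ rayFib 𝔪 𝔟 N 𝔞' ↔ x ∈ rayCosetPosReps 𝔪 𝔟 N ∧ spanSingleton (𝓞 K)⁰ x = spanSingleton (𝓞 K)⁰ x₀ := by
  have h0 : (𝔟 : FractionalIdeal (𝓞 K)⁰ K) ≠ 0 := coeIdeal_ne_zero.mpr h𝔟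
  simp only [rayFib, Set.mem_setOf_eq, h𝔞']
  rw [(mul_left_injective₀ h0).eq_iff]

/-- `𝔟 = 1 · 𝔟`. [folklore] -/
theorem coeIdeal_eq_spanSingleton_one_mul (𝔟 : Ideal (𝓞 K)) :
    (𝔟 : FractionalIdeal (𝓞 K)⁰ K) = spanSingleton (𝓞 K)⁰ (1 : K) * 𝔟 := by
  rw [spanSingleton_one, one_mul]

/-- **All nonempty fibres are in bijection with the fibre over `𝔟`.** [folklore] -/
def rayFibEquiv (h𝔟 : 𝔟 ≠ ⊥) {N : ℕ} (hN0 : N ≠ 0) (hN : Even N)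
    (hV : ∀ i, (((fundSystem K i : (𝓞 K)ˣ) : K) ^ N - 1) * 1 ∈ rayCosetIdeal 𝔪 𝔟) {𝔞' : Ideal (𝓞 K)} {x₀ : K}
    (hx₀ : x₀ ∈ rayCosetPos 𝔪 𝔟) (h𝔞' : (𝔞' : FractionalIdeal (𝓞 K)⁰ K) = spanSingleton (𝓞 K)⁰ x₀ * 𝔟) :
    rayFib 𝔪 𝔟 N 𝔞' ≃ rayFib 𝔪 𝔟 N 𝔟 :=
  ((Equiv.setCongr (Set.ext fun x ↦ mem_rayFib_iff (𝔪 := 𝔪) h𝔟 h𝔞' x)).trans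
    (fibEquiv hN0 hN hV hx₀ (one_mem_rayCosetPos 𝔪 𝔟))).trans
    (Equiv.setCongr (Set.ext fun x ↦ mem_rayFib_iff (𝔪 := 𝔪) h𝔟 (coeIdeal_eq_spanSingleton_one_mul 𝔟) x)).symm

/-- The fibre over `𝔟` is nonempty (`boxRep 1`). [folklore] -/
theorem boxRep_one_mem_rayFib {N : ℕ} (hN0 : N ≠ 0) (hN : Even N)
    (hV : ∀ i, (((fundSystem K i : (𝓞 K)ˣ) : K) ^ N - 1) * 1 ∈ rayCosetIdeal 𝔪 𝔟) :
    boxRep K N 1 ∈ rayFib 𝔪 𝔟 N 𝔟 :=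
  ⟨boxRep_mem_rayCosetPosReps hN0 hN hV (one_mem_rayCosetPos 𝔪 𝔟), by
    rw [spanSingleton_boxRep, spanSingleton_one, one_mul]⟩

/-- Points of the fibre over `𝔟` generate `(1)` and have norm `±1`. [folklore] -/
theorem abs_norm_eq_one_of_mem_rayFib {N : ℕ} {x : K} (hx : x ∈ rayFib 𝔪 𝔟 N 𝔟) (h𝔟 : 𝔟 ≠ ⊥) :
    (|(Algebra.norm ℚ x : ℚ)| : ℝ) = 1 := by
  have h := ((mem_rayFib_iff (𝔪 := 𝔪) h𝔟 (coeIdeal_eq_spanSingleton_one_mul 𝔟) x).mp hx).2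
  rw [spanSingleton_one] at h
  have := FractionalIdeal.absNorm_span_singleton (𝓞 K) x
  rw [h, absNorm_one] at this
  have h2 : |(Algebra.norm ℚ x : ℚ)| = 1 := this.symm
  exact_mod_cast h2

/-- **The fibre over `𝔟` is finite** (its points have `|N(x)| = 1` and `Σ_{x ∈ ℜ} |N(x)|^{-2} < ∞`,
`summable_pieceReps_norm_rpow` of `HeckePieceDirichlet.lean`). [folklore] -/
theorem finite_rayFib (h𝔟 : 𝔟 ≠ ⊥) (N : ℕ) : Finite (rayFib 𝔪 𝔟 N 𝔟) := by
  have hsum := summable_pieceReps_norm_rpow ∅ 1 (rayCosetIdeal 𝔪 𝔟) 1 N (σ := 2) one_lt_two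
  -- restrict to the fibre along the inclusion
  let ι : rayFib 𝔪 𝔟 N 𝔟 → pieceReps K ∅ 1 (rayCosetIdeal 𝔪 𝔟) 1 N := fun x ↦ ⟨x, x.2.1.1⟩
  have hι : Function.Injective ι := fun a b h ↦
    Subtype.ext (congrArg (fun z : pieceReps K ∅ 1 (rayCosetIdeal 𝔪 𝔟) 1 N ↦ (z : K)) h)
  have h1 : Summable fun x : rayFib 𝔪 𝔟 N 𝔟 ↦ (1 : ℝ) := by
    refine (hsum.comp_injective hι).congr fun x ↦ ?_
    simp only [Function.comp_apply, ι]
    rw [abs_norm_eq_one_of_mem_rayFib x.2 h𝔟, Real.one_rpow]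
  by_contra hinf
  rw [not_finite_iff_infinite] at hinf
  exact one_ne_zero ((summable_const_iff (1 : ℝ)).mp h1)

variable (𝔪 𝔟) in
/-- **The common size `d` of the nonempty fibres** (`= #(U/V)`): the number of box representatives generating
the unit ideal. [folklore] -/
def rayFibCard (N : ℕ) : ℕ := Nat.card (rayFib 𝔪 𝔟 N 𝔟)

/-- `d > 0`. [folklore] -/
theorem rayFibCard_pos (h𝔟 : 𝔟 ≠ ⊥) {N : ℕ} (hN0 : N ≠ 0) (hN : Even N)
    (hV : ∀ i, (((fundSystem K i : (𝓞 K)ˣ) : K) ^ N - 1) * 1 ∈ rayCosetIdeal 𝔪 𝔟) : 0 < rayFibCard 𝔪 𝔟 N := by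
  haveI := finite_rayFib (𝔪 := 𝔪) h𝔟 N
  haveI : Nonempty (rayFib 𝔪 𝔟 N 𝔟) := ⟨⟨_, boxRep_one_mem_rayFib hN0 hN hV⟩⟩
  exact Nat.card_pos

/-- **Each ideal of the class is hit exactly `d` times, the others not at all**:
`#{x ∈ T_N | x𝔟 = 𝔞'} = d · 𝟙[𝔞' ∼ 𝔟]`. [folklore] -/
theorem card_rayFib (h𝔟 : 𝔟 ≠ ⊥) (hcop : IsCoprime 𝔟 𝔪) {N : ℕ} (hN0 : N ≠ 0) (hN : Even N)
    (hV : ∀ i, (((fundSystem K i : (𝓞 K)ˣ) : K) ^ N - 1) * 1 ∈ rayCosetIdeal 𝔪 𝔟) (𝔞' : Ideal (𝓞 K)) :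
    Nat.card (rayFib 𝔪 𝔟 N 𝔞') = if RayClassRel 𝔪 𝔟 𝔞' then rayFibCard 𝔪 𝔟 N else 0 := by
  split_ifs with h
  · obtain ⟨x₀, hx₀, h𝔞'⟩ := exists_mem_rayCosetPos_of_rayClassRel h𝔟 h
    exact Nat.card_congr (rayFibEquiv h𝔟 hN0 hN hV hx₀ h𝔞')
  · rw [Nat.card_eq_zero]
    left
    exact ⟨fun x ↦ h (rayClassRel_of_mem_rayFib h𝔟 hcop x.2)⟩

end NumberField

end Literature.NumberTheory.LFunctions
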